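import Summits.MatrixMultiplication.OmegaCensus.STPP211Z2pow5RoomEngineSel

/-!
# (2,1,1)⁶ in (ℤ/2)⁵ — the X-ROOM CERTIFICATE, kernel decision for `{0,1,2,4,8,15}`, chunk 4/5 (first code in codes 12–17)

Cell `pub-omega` (unit `pub-omega-stpp-1-g35`), topic `Summits/MatrixMultiplication/OmegaCensus`.
HONEST FRAMING (verbatim): lottery ticket; floor = certified bounds/negative ranges. Census STRUCTURE bookkeeping (B5, T1 column at `(ℤ/2)⁵`);
nothing here is a bound on `ω`.

`decide +kernel` evaluation of `T1Z2p5.goSel` (`STPP211Z2pow5RoomEngineSel`) on the packed translate tables of the `c`-code list `[0, 1, 2, 4, 8, 15]`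
(literal tables; their equality with `mkTabs [0,1,2,4,8,15]` is re-checked in the assembling file) with the first block's smaller code restricted to
codes 12–17 (selection mask `258048`): 153,574 placements (seat's C twin `firstsplit.c`).
-/

namespace Summit.MatrixMultiplication.OmegaCensus

namespace T1Z2p5

/-- Chunk 4/5 of the representative `{0,1,2,4,8,15}`: the engine accepts (kernel evaluation; 153,574 placements). -/
theorem goSel_R3_4 : goSel 258048
    163269795384038562701458916354132282246328974415189674448535954300271226296379708664160810205895086718137172868943606584440703880072223501402196384002015511528734657979549814444724183871613272007091562794469989421484712509446547601219833089290458692361434568798344985083499084787241582250773659674858779345175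
    [149052504863069939380106881894580749306216216507445995286853915666353625746437697812562536051309732502908023662469226871418750893523970981616298570625946475166736186095436894443725999327515002161948987527714182897598729024174788406856445942706235739795872727735763548750952891607269997465056909783412229816875, 125094601035124431329780478298266762338623576800684733535747407650436920104184020516471407587920317446615625821650341663068528231774400843460801710649387415550223557909526138438917273166415659269784534131941816520492057179294840977006531706891501049414800388015139049904141151486234926692216802988146737292365, 99781624575832043191167018050238397077823625002775710417006529303077827949490412008380810985669144873670520883351690151149445267339530921330237372568158591913142867630500565661029788024798639560361072069474104950833693396322795112300236696139539546318353867117982987478121269328066354178242944682560132749425, 91223271026827802951543007360883088748049043928358996626695670940549902761652453717188485945931944159773508822672859127147972897489985035862930297062505169633527054083329761409870509988127902593925341684907208526945223887098176690152908004243948340013112843534993479103654458457988226309768432205025832343425, 90649971061530927440188105504445027181072126165880388519429100636787615197683485971859366028861962300234543892322607509439666961444982540323275841961027573121417539493897916863288957909702267607971808372563880075513449797231657205548685040944542193480982042848515606736685266168763132494297173399601040910465] 0 0 = true := by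
  decide +kernel

end T1Z2p5

end Summit.MatrixMultiplication.OmegaCensus
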